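import Summits.Ventures.Crystal3D.Theorems.StickyWulffConstantTextureLiminfTexShadowCoverageBarlowSteerWideDefs
import HarnessLib

/-!
# TexShadow row (e) / EDGE-ON option (ε₂): the TWO-SIDED steered coverage certificate (both plates steered, wide tilt 1/3, two-sided flux sum)
# (lane T, crux `TextureLiminfV5`, stmt-Ventures-23912, sub-crux EDGE-ON `stub_edgeOn`; cf-p1 Q-ε₂ (cxvii)(2) / (cxviii)(3); HOME/wall-p2-g11/EPSILON-SIZING.md)

HONEST FRAMING. Venture `Summits/Ventures/Crystal3D` (cell `crystal3d-full`), route `route-Ventures-StickyWulffConstant`, helper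
`--supports` the law-v5 crux `TextureLiminfV5` (stmt-Ventures-23912), registered line `TexShadow` v8.5, stub `stub_edgeOn` (K4).
DEFINITIONS ONLY (+ inclusions); no certificate is asserted; rung F-C1 not moved.

THE POINT.  Every certificate typed so far (`…CoverageBarlowDefs/AtDefs/SteerDefs/SteerWideDefs`) is ONE-SIDED: one plate's walker family alone pays the
whole charge, so each of its strips must rise `≥ √2·c₀` in `e₃` — which is exactly what FAILS on the EDGE-ON regime `EdgeOnAt c₀` (K4: neither plate is
flux-feasible).  Lane G's frame-separated ledger is STATE-ADDITIVE (`walkerFamilies_card_le_payers_sep`: per payer ball `deg + #ES₁ + #ES₂ ≤ 12`), so BOTH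
plates' steered families can be paid by the same payer window (`barlow_hlines_oriented_apart_at_tiltWide`, 19480-p2 g12 G1–G3) and the T-side two-family
`IsUpBond` glue (`bilayerWallAt_of_lineCount_up₂`, T1) charges a table against the SUM of the two plates' strip rises.  This file types the per-box verdict:
* `steerRise L w e z v i` — the `e`-rise of the steered family's step on bilayer `i` of the presented word `w`: the launch slot's `⟪L v, e⟫` on Δ-bilayers,
  the `z`-capper's on ∇-bilayers;
* **`BarlowTwoSidedCertifiedSteerWide c₀ σ₁ σ₂ L₁ L₂ z₁ v₁ z₂ v₂`** — plate 1 UP along `z₁` (‖z₁ − e₃‖ ≤ 1/3, slot `v₁` steep for `z₁`, ∇-capper `e₃`-rise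
  `≥ 1/4`), plate 2 DOWN along `z₂` (‖z₂ + e₃‖ ≤ 1/3, …), the TWO-SIDED flux clause `√2·c₀ ≤ steerRise₁ i + steerRise₂ j` for all bilayer pairs, and the
  frame clauses (i), (ii), (iii)_z for `chainFrames z₁ (upFrame L₁ e₃) v₁` / `chainFrames z₂ (upFrame L₂ (−e₃)) v₂` ((i)/(ii) against the ORIGINAL frames'
  two lattices, as in the one-sided defs; (iii)_z = `¬ CoAxFrames`);
* **`BarlowMenuSteer2WideCertified`** := `BarlowMenuSteerWideCertified ∨ ∃ z₁ v₁ z₂ v₂, TwoSided…`; schema **`ResidualSteer2WideCoverageBarlowOn Reg c₀`**; inclusions.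
WHAT THIS IS NOT: no certificate; pairs with NO steerable up-slot on a plate (no up-slot of `e₃`-rise ≥ 0.4354) or with `rise₁ + rise₂ < √2·c₀` on some
bilayer pair stay uncertified (the EDGE-ON corner); F-C1 not moved.
-/

noncomputable section

open scoped BigOperators InnerProductSpace ENNReal
open MeasureTheory Filter

namespace Summit.Ventures.Crystal3D.Cruxes.TextureLiminf.TexShadow

open Summit.Ventures.Crystal3D Summit.Ventures.Crystal3D.Theorems
open Literature.MathematicalPhysics.StatisticalMechanics (IsHaggSeq fccStacking barlowStacking basalMirror)

/-! ## The steered step rise -/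

/-- **The `e`-rise of a steered family's step on bilayer `i`** of a plate presented by the frame `L` with (presented) word `w`: the launch slot
`v` on Δ-bilayers (`w i = 1`), the `z`-best ∇-capper `basalMirror (bestCapper (twinFrame L (L e₃)) (L e₃) z)` on ∇-bilayers. -/
def steerRise (L : E3 ≃ₗᵢ[ℝ] E3) (w : ℤ → ℤ) (e z v : E3) (i : ℤ) : ℝ :=
  if w i = 1 then ⟪L v, e⟫_ℝ else ⟪L (basalMirror (bestCapper (twinFrame L (L e₃)) (L e₃) z)), e⟫_ℝ

/-- Unfolding on a Δ-bilayer. -/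
theorem steerRise_of_eq_one (L : E3 ≃ₗᵢ[ℝ] E3) {w : ℤ → ℤ} (e z v : E3) {i : ℤ} (h : w i = 1) :
    steerRise L w e z v i = ⟪L v, e⟫_ℝ := by
  unfold steerRise; rw [if_pos h]

/-- Unfolding on a ∇-bilayer. -/
theorem steerRise_of_eq_neg_one (L : E3 ≃ₗᵢ[ℝ] E3) {w : ℤ → ℤ} (e z v : E3) {i : ℤ} (h : w i = -1) :
    steerRise L w e z v i = ⟪L (basalMirror (bestCapper (twinFrame L (L e₃)) (L e₃) z)), e⟫_ℝ := by
  unfold steerRise; rw [if_neg (by omega)]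

/-! ## The two-sided steered certificate -/

/-- **BOTH families STEERED (wide tilt 1/3), chosen slots, certified TWO-SIDEDLY at charge `c₀`** (= the hypotheses of
`barlow_hlines_oriented_apart_at_tiltWide` for the up-presentations `upFrame L₁ e₃`, `upFrame L₂ (−e₃)` + the two-sided flux test (γ₂)). -/
def BarlowTwoSidedCertifiedSteerWide (c₀ : ℝ) (σ₁ σ₂ : ℤ → ℤ) (L₁ L₂ : E3 ≃ₗᵢ[ℝ] E3) (z₁ v₁ z₂ v₂ : E3) : Prop :=
  -- plate 1, UP family steered by `z₁`
  ‖z₁‖ = 1 ∧ ‖z₁ - e₃‖ ≤ 1 / 3 ∧ v₁ ∈ fccSlots ∧ v₁ 2 = Real.sqrt (2 / 3) ∧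
    Real.sqrt 2 / 2 ≤ ⟪upFrame L₁ e₃ v₁, z₁⟫_ℝ ∧
    (∀ i : ℤ, upWord L₁ σ₁ e₃ i = -1 →
      (1 / 4 : ℝ) ≤ ⟪upFrame L₁ e₃ (basalMirror (bestCapper (twinFrame (upFrame L₁ e₃) (upFrame L₁ e₃ e₃)) (upFrame L₁ e₃ e₃) z₁)), e₃⟫_ℝ) ∧
  -- plate 2, DOWN family steered by `z₂`
  ‖z₂‖ = 1 ∧ ‖z₂ - (-e₃)‖ ≤ 1 / 3 ∧ v₂ ∈ fccSlots ∧ v₂ 2 = Real.sqrt (2 / 3) ∧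
    Real.sqrt 2 / 2 ≤ ⟪upFrame L₂ (-e₃) v₂, z₂⟫_ℝ ∧
    (∀ j : ℤ, upWord L₂ σ₂ (-e₃) j = -1 →
      (1 / 4 : ℝ) ≤ ⟪upFrame L₂ (-e₃) (basalMirror (bestCapper (twinFrame (upFrame L₂ (-e₃)) (upFrame L₂ (-e₃) e₃))
        (upFrame L₂ (-e₃) e₃) z₂)), -e₃⟫_ℝ) ∧
  -- (γ₂) the TWO-SIDED flux clause: on every pair of bilayers the two families' `±e₃`-rises sum to `≥ √2·c₀`
  (∀ i j : ℤ, Real.sqrt 2 * c₀ ≤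
      steerRise (upFrame L₁ e₃) (upWord L₁ σ₁ e₃) e₃ z₁ v₁ i + steerRise (upFrame L₂ (-e₃)) (upWord L₂ σ₂ (-e₃)) (-e₃) z₂ v₂ j) ∧
  -- (i) no chain frame of family 1 carries plate 2's bilayer lattice or its basal twin's
  (∀ F ∈ chainFrames z₁ (upFrame L₁ e₃) v₁,
      F '' fccStacking 1 (Real.sqrt (2 / 3)) ≠ L₂ '' fccStacking 1 (Real.sqrt (2 / 3)) ∧
      F '' fccStacking 1 (Real.sqrt (2 / 3)) ≠ (twinFrame L₂ (L₂ e₃)) '' fccStacking 1 (Real.sqrt (2 / 3))) ∧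
  -- (ii) symmetrically
  (∀ F ∈ chainFrames z₂ (upFrame L₂ (-e₃)) v₂,
      F '' fccStacking 1 (Real.sqrt (2 / 3)) ≠ L₁ '' fccStacking 1 (Real.sqrt (2 / 3)) ∧
      F '' fccStacking 1 (Real.sqrt (2 / 3)) ≠ (twinFrame L₁ (L₁ e₃)) '' fccStacking 1 (Real.sqrt (2 / 3))) ∧
  -- (iii)_z no chain frame of family 1 is Barlow-coaxial with a chain frame of family 2
  (∀ F₁ ∈ chainFrames z₁ (upFrame L₁ e₃) v₁, ∀ F₂ ∈ chainFrames z₂ (upFrame L₂ (-e₃)) v₂, ¬ CoAxFrames F₁ F₂)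

/-- **Certified over the TWO-SIDED WIDE-STEERED menu**: the one-sided wide-steered menu, or some two-sided steered pair of families. -/
def BarlowMenuSteer2WideCertified (c₀ : ℝ) (σ₁ σ₂ : ℤ → ℤ) (L₁ L₂ : E3 ≃ₗᵢ[ℝ] E3) : Prop :=
  BarlowMenuSteerWideCertified c₀ σ₁ σ₂ L₁ L₂ ∨
    ∃ z₁ v₁ z₂ v₂ : E3, BarlowTwoSidedCertifiedSteerWide c₀ σ₁ σ₂ L₁ L₂ z₁ v₁ z₂ v₂

/-! ## The certificate schema -/

/-- **THE BARLOW COVERAGE CERTIFICATE ON `Reg`, TWO-SIDED WIDE-STEERED MENU** (schema). -/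
def ResidualSteer2WideCoverageBarlowOn (Reg : (ℤ → ℤ) → (ℤ → ℤ) → (E3 ≃ₗᵢ[ℝ] E3) → (E3 ≃ₗᵢ[ℝ] E3) → Prop) (c₀ : ℝ) : Prop :=
  ∀ (σ₁ σ₂ : ℤ → ℤ), IsHaggSeq σ₁ → IsHaggSeq σ₂ → ¬ BothFcc σ₁ σ₂ →
    ∀ (L₁ L₂ : E3 ≃ₗᵢ[ℝ] E3), Reg σ₁ σ₂ L₁ L₂ → BarlowMenuSteer2WideCertified c₀ σ₁ σ₂ L₁ L₂

/-! ## Inclusions -/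

/-- A wide steered (one-sided) certificate is a two-sided-menu one. -/
theorem steer2WideCoverageBarlowOn_of_steerWideCoverageBarlowOn {Reg : (ℤ → ℤ) → (ℤ → ℤ) → (E3 ≃ₗᵢ[ℝ] E3) → (E3 ≃ₗᵢ[ℝ] E3) → Prop}
    {c₀ : ℝ} (h : ResidualSteerWideCoverageBarlowOn Reg c₀) : ResidualSteer2WideCoverageBarlowOn Reg c₀ :=
  fun σ₁ σ₂ hσ₁ hσ₂ hf L₁ L₂ hreg => Or.inl (h σ₁ σ₂ hσ₁ hσ₂ hf L₁ L₂ hreg)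

/-- A menu certificate is a two-sided-menu certificate. -/
theorem steer2WideCoverageBarlowOn_of_menuCoverageBarlowOn {Reg : (ℤ → ℤ) → (ℤ → ℤ) → (E3 ≃ₗᵢ[ℝ] E3) → (E3 ≃ₗᵢ[ℝ] E3) → Prop} {c₀ : ℝ}
    (h : ResidualMenuCoverageBarlowOn Reg c₀) : ResidualSteer2WideCoverageBarlowOn Reg c₀ :=
  steer2WideCoverageBarlowOn_of_steerWideCoverageBarlowOn (steerWideCoverageBarlowOn_of_menuCoverageBarlowOn h)

/-- Two-sided-menu certificates restrict along implications of regimes. -/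
theorem steer2WideCoverageBarlowOn_mono {Reg Reg' : (ℤ → ℤ) → (ℤ → ℤ) → (E3 ≃ₗᵢ[ℝ] E3) → (E3 ≃ₗᵢ[ℝ] E3) → Prop}
    (hle : ∀ σ₁ σ₂ L₁ L₂, Reg' σ₁ σ₂ L₁ L₂ → Reg σ₁ σ₂ L₁ L₂) {c₀ : ℝ} (h : ResidualSteer2WideCoverageBarlowOn Reg c₀) :
    ResidualSteer2WideCoverageBarlowOn Reg' c₀ :=
  fun σ₁ σ₂ hσ₁ hσ₂ hf L₁ L₂ hreg => h σ₁ σ₂ hσ₁ hσ₂ hf L₁ L₂ (hle σ₁ σ₂ L₁ L₂ hreg)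

end Summit.Ventures.Crystal3D.Cruxes.TextureLiminf.TexShadow

end
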